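import Mathlib.FieldTheory.ChevalleyWarning
import Mathlib.Algebra.CharP.Lemmas
import Literature.FieldTheory.QuasiAlgClosed.Basic
import HarnessLib

/-!
# Chevalley's theorem: a finite field is quasi-algebraically closed (`C₁`)

Serre, *Cohomologie galoisienne*, II §3.3 (a): "Un corps fini est `(C₁)`: théorème de Chevalley".
With the predicate `Literature.FieldTheory.QuasiAlgClosed.IsCr` of `Basic.lean` (Lang's property
`(C_r)`; `(C₁)` = quasi-algebraically closed) this is **proved** here from Mathlib's
Chevalley–Warning theorem `char_dvd_card_solutions` (`Mathlib/FieldTheory/ChevalleyWarning.lean`: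
over a finite field of characteristic `p`, the number of zeros of a polynomial of total degree
`< n` in `n` variables is divisible by `p`): a form of degree `1 ≤ d < n` vanishes at the origin,
so it has at least `p ≥ 2` zeros, one of which is non-trivial.

## References

* J.-P. Serre, *Cohomologie galoisienne*, II §3.3 (a). [SerreGaloisCohomology1997]
* C. Chevalley, Démonstration d'une hypothèse de M. Artin, Abh. Math. Sem. Hamburg 11 (1935)
  (as cited by Serre, [31]); Mathlib `char_dvd_card_solutions`.
-/

noncomputable section

open MvPolynomial

namespace Literature.FieldTheory.QuasiAlgClosed

/-- A form of positive degree vanishes at the origin (its constant coefficient is the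
coefficient of the monomial of degree `0 ≠ d`). [folklore] -/
theorem eval_zero_of_isHomogeneous {k : Type*} [CommRing k] {n d : ℕ}
    {f : MvPolynomial (Fin n) k} (hf : f.IsHomogeneous d) (hd : 0 < d) :
    MvPolynomial.eval (0 : Fin n → k) f = 0 := by
  rw [MvPolynomial.eval_zero, MvPolynomial.constantCoeff_eq]
  exact hf.coeff_eq_zero (d := 0) (by simp; omega)

/-- **Chevalley's theorem: a finite field is `(C₁)`** (Serre II §3.3 (a): "Un corps fini est
`(C₁)`: théorème de Chevalley"), proved from Mathlib's Chevalley–Warning theorem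
`char_dvd_card_solutions`: for a form `f` of degree `1 ≤ d < n` in `n` variables over a finite
field of characteristic `p`, `p` divides the number of zeros of `f` in `kⁿ`, and `0` is a zero
(`eval_zero_of_isHomogeneous`), so there are at least `p ≥ 2` zeros.
[cite: SerreGaloisCohomology1997, II §3.3 (a)] -/
theorem isCr_one_of_finite (k : Type*) [Field k] [Finite k] : IsCr 1 k := by
  classical
  haveI := Fintype.ofFinite k
  intro n d f hd hf hdn
  rw [pow_one] at hdn
  obtain ⟨p, hp⟩ := CharP.exists k
  haveI := hp
  have hprime : p.Prime := CharP.char_is_prime k p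
  have hdeg : f.totalDegree < Fintype.card (Fin n) := by
    rw [Fintype.card_fin]
    exact lt_of_le_of_lt hf.totalDegree_le hdn
  have hdvd := char_dvd_card_solutions p hdeg
  have h0 : MvPolynomial.eval (0 : Fin n → k) f = 0 := eval_zero_of_isHomogeneous hf hd
  have hpos : 0 < Fintype.card {x : Fin n → k // MvPolynomial.eval x f = 0} :=
    Fintype.card_pos_iff.2 ⟨⟨0, h0⟩⟩
  have hcard : 1 < Fintype.card {x : Fin n → k // MvPolynomial.eval x f = 0} :=
    lt_of_lt_of_le hprime.one_lt (Nat.le_of_dvd hpos hdvd)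
  obtain ⟨⟨x, hx⟩, hne⟩ := Fintype.exists_ne_of_one_lt_card hcard ⟨0, h0⟩
  exact ⟨x, fun h => hne (Subtype.ext h), hx⟩

/-- A finite field is `(C_r)` for every `r ≥ 1` (`IsCr.mono`). [folklore] -/
theorem isCr_of_finite (k : Type*) [Field k] [Finite k] {r : ℕ} (hr : 1 ≤ r) : IsCr r k :=
  (isCr_one_of_finite k).mono hr

end Literature.FieldTheory.QuasiAlgClosed

end
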